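import Summits.BirchSwinnertonDyer.BirchSwinnertonDyer.Theorems.CMKolyvaginAtInertTwoGenusDefectBSDConsistencyAtTwo
import Summits.BirchSwinnertonDyer.BirchSwinnertonDyer.Theses.CMKolyvaginAtInertTwo
import HarnessLib

/-!
# Route `CMKolyvaginAtInertTwo`, item R0 `CMHeegnerTwoPrimitiveOfTrivialShaTwo` (stmt-BirchSwinnertonDyer-28176) —
# R0 IS A CONSEQUENCE OF THE ROUTE'S OWN TARGET: `WAllCornerFTwo` ∧ (five prints) ⟹ R0

Seat `bsd-line-cmk2-p1` g23 (cell `bsd-print-cf2`), `--supports stmt-BirchSwinnertonDyer-28176` (helper; closes nothing).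
THEOREMS ONLY (no definition, no named fact, no `sorry`).  BSD is NOT proved by this: the leaf `WAllCornerFTwo`
(BSD₂ for CM curves of analytic rank one) is a HYPOTHESIS here.  This is the BSD-TRUTH CERTIFICATE of R0 (the
analogue for 28176 of g21's p759429 for 24277): R0 can only be refuted by refuting BSD₂ on H₂ (or a print).

Mechanism.  On an R0 frame (E ∈ H₂, `K` Heegner with odd `d_K ≠ −3`, optimal odd-Manin frame, `y_K = P(1)` of
infinite order, `Ш(E_K)(2) = ⊥`) suppose `y_K = 2Q` in `E(K[1])`.  Let `2^{M₀} ∥ y_K` (`M₀` exists, `E(K[1])`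
finitely generated); then `M₀ ≥ 1`.  Gross–Zagier makes the twin `E^{(d_K)}` of analytic rank `0`, Burungale–Flach
(print `bsdTriple_of_hasCM_of_L_one_ne_zero`) gives `BSD₂` of its globally minimal CM model `Wd`, the leaf gives
`BSD₂(E)`, and g21's exact descent read backwards
(`card_primaryComponent_sha_two_baseChange_eq_pow_of_bsdp_of_printedInputs`) yields `#Ш(E_K)(2) = 2^{2M₀} ≥ 4`,
contradicting `Ш(E_K)(2) = ⊥`.

* `cmHeegnerTwoPrimitiveOfTrivialShaTwo_of_wAllCornerFTwo_of_prints` — **leaf ∧ (GZ, GZK, modularity, Milne,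
  Burungale–Flach) ⟹ R0 (28176) BY NAME**.

References: [GrossZagier1986] V.§2; [McCallumLMS1991] §5 Lemma 5.1; [Milne1972ArithmeticAV] Thm. 1;
[BurungaleFlach2024] Thm. 1.1, Cor. 2; [GrossLMS1991] §2 (2.2)–(2.4).
-/

set_option autoImplicit false
-- the Theorems namespace of this sub repeats the summit name by design (D-0017 nested layout)
set_option linter.dupNamespace false

noncomputable section

open scoped Classical

open WeierstrassCurve NumberField Literature.NumberTheory.EllipticCurves
  Literature.NumberTheory.EllipticCurves.ModularForms
  Literature.NumberTheory.EllipticCurves.Rank1Residual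
  Summit.BirchSwinnertonDyer.Rank1Residual
open Summit.BirchSwinnertonDyer.BirchSwinnertonDyer.Theorems.CMExactDescent
open Summit.BirchSwinnertonDyer.BirchSwinnertonDyer.Theses.CMKolyvaginAtInertTwo (CMHeegnerTwoPrimitiveOfTrivialShaTwo)

namespace Summit.BirchSwinnertonDyer.BirchSwinnertonDyer.Theorems.KolyvaginGenusTwo

/-- **R0 is BSD-true: `WAllCornerFTwo` ∧ (Gross–Zagier at every level, GZK, modularity, Milne any-model,
Burungale–Flach) ⟹ `CMHeegnerTwoPrimitiveOfTrivialShaTwo` (stmt-28176) by name.**  On a frame of R0's hypotheses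
with `Ш(E_K)(2) = ⊥`, a `2`-divisible `y_K` would have exact exponent `M₀ ≥ 1`, while BSD₂ of the pair (the twin's
from print, `E`'s from the leaf) forces `#Ш(E_K)(2) = 2^{2M₀}` (g21), i.e. `1 = 2^{2M₀}`.  The leaf is a
HYPOTHESIS; nothing is closed; this certifies that R0 is a necessary condition for the route's target.
[cite: GrossZagier1986, V.§2 (p. 312)] [cite: McCallumLMS1991, §5 Lemma 5.1] [cite: Milne1972ArithmeticAV, Thm. 1]
[cite: BurungaleFlach2024, Thm. 1.1 and Cor. 2] -/
theorem cmHeegnerTwoPrimitiveOfTrivialShaTwo_of_wAllCornerFTwo_of_prints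
    (hGZ : ∀ (N : ℕ) [NeZero N] (W : WeierstrassCurve ℚ) (K : Type) [Field K] [NumberField K], gross_zagier N W K)
    (hGZK : rank_eq_analyticRank_of_analyticRank_le_one) (hnf : exists_isNewformOf)
    (hMilneC : Milne1972.bsdQuotient_baseChange_quadratic_anyModel) (hBF : bsdTriple_of_hasCM_of_L_one_ne_zero)
    (hLeaf : Summit.BirchSwinnertonDyer.WAllCornerFTwo) :
    CMHeegnerTwoPrimitiveOfTrivialShaTwo := by
  intro W _ _ _ hCM _hin hρ hr hT K _ _ hIQ hodd h3 hHe Dt _hDt hc β ι d₁ hy hsha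
  rintro ⟨Q, hQ⟩
  have hmod : hasEntireLFunction_rat := hasEntireLFunction_rat_of_exists_isNewformOf hnf
  -- the exact `2`-divisibility exponent `M₀` of `y_K = P(1)` in `E(K[1])`
  haveI : NumberField (ringClassField K ι 1) := numberField_ringClassField hIQ ι one_ne_zero
  haveI : (W.baseChange (ringClassField K ι 1)).IsElliptic := by rw [baseChange]; infer_instance
  haveI : Module.Finite ℤ (W.baseChange (ringClassField K ι 1)).toAffine.Point := by
    convert (W.baseChange (ringClassField K ι 1)).module_finite_point_holds
  obtain ⟨M₀, hdiv, hndiv⟩ := exists_pow_smul_eq_and_not_of_not_isOfFinAddOrder Nat.prime_two hy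
  -- the twin has `L(E^{(d_K)}, 1) ≠ 0` (Gross–Zagier: `y_K` non-torsion ⟹ `L′(E/K, 1) ≠ 0 = L′(E,1)·L(E^{(d_K)},1)`)
  obtain ⟨P₀, Hd, hP₀, hP₀K⟩ := exists_heegnerPoint_map_eq_derivedPoint_one hIQ hHe d₁
  have hPinf : ¬ IsOfFinAddOrder P₀ := by
    intro hfin
    apply hy
    rw [← hP₀K]
    exact (WeierstrassCurve.Affine.Point.map (W' := W) (algebraMap K (ringClassField K ι 1)).toRatAlgHom).isOfFinAddOrder hfin
  have hLK : LDerivEK W K ≠ 0 :=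
    (lDerivEK_ne_zero_iff_not_isOfFinAddOrder W (W.conductorNorm ℤ) K (hGZ _ W K) hIQ hHe ⟨Dt, Hd, ι, hP₀⟩).mpr hPinf
  have hL0 : W.entireLFunction 1 = 0 := entireLFunction_one_eq_zero_of_analyticRank_eq_one hr
  have hLt : (W.quadraticTwist (NumberField.discr K : ℚ)).entireLFunction 1 ≠ 0 := by
    intro h0
    apply hLK
    rw [Literature.NumberTheory.EllipticCurves.KrizLi2019.lDerivEK_eq_deriv_mul W K hmod hL0, h0, mul_zero]
  -- the globally minimal CM twin of analytic rank `0`; BSD₂ of the twin from PRINT, of `E` from the LEAF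
  obtain ⟨Wd, _, _, hWd, hcmd, hrd⟩ := CMSupply.exists_minimal_twin_hasCM_analyticRank_zero hnf W hCM K hLt
  have hBd : BSDp Wd 2 := Summit.BirchSwinnertonDyer.Rank1Residual.bsdp_cm_rankZero (p := 2) hBF hmod hcmd hrd
  have hBW : BSDp W 2 := hLeaf W hCM hr
  -- g21: `#Ш(E_K)(2) = 2^{2M₀}`; with `Ш(E_K)(2) = ⊥` this is `1 = 2^{2M₀}`, so `M₀ = 0`
  have hcard := card_primaryComponent_sha_two_baseChange_eq_pow_of_bsdp_of_printedInputs hGZ hGZK hmod hMilneC W hρ hr hT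
    K hIQ hodd h3 hHe Dt hc β ι d₁ hy M₀ hdiv hndiv Wd hWd hBd hBW
  rw [hsha, AddSubgroup.card_bot] at hcard
  have hM : M₀ = 0 := by
    have h := (Nat.pow_eq_one.mp hcard.symm).resolve_left (by norm_num)
    omega
  subst hM
  exact hndiv ⟨Q, by simpa using hQ⟩

end Summit.BirchSwinnertonDyer.BirchSwinnertonDyer.Theorems.KolyvaginGenusTwo

end
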